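import Summits.NavierStokesRegularity.FluidComputer.LevelOccupationFloor
import Summits.NavierStokesRegularity.FluidComputer.TerminalWindowFloor

/-!
# Fluid computer — the OCCUPATION (clock) floor holds inside every terminal window (conditional on Cheskidov–Dai)

HONEST FRAMING (cell `pub-fluidc`, verbatim): *low prior, high value-of-information experiment on Tao's
machine paradigm; NOT a claim that NS blows up.* Theorem side of the cell; nothing here is evidence of blow-up.

RULING R35 (F4/F6) makes the level-OCCUPATION floor — pub-fluidc-lit's `LevelOccupationFloor.occupation_floor` /
`residence_floor`, the contrapositive of Cheskidov–Dai's criterion [CheskidovDai2015, Thm. 1.1] (tree: named fact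
`Literature.Analysis.FluidPDE.cheskidov_dai_occupation`, NOT proved) — the rung's CLOCK: at infinitely many levels
`q`, `2^q · U_q · R_q > c` with the level sup-amplitude `U_q` and the residence time `R_q` of the front `Λ` at or above
level `q`, both measured on the LAST HALF `(T/2, T)` of the lifespan. The restart trick of `TerminalWindowFloor`
cannot move this window (the named fact's rendering asks for a rapidly decaying datum, which `u(s)` need not be), but
the Bernstein step of Cheskidov–Shvydkoy 2014, Lemma 4.1 can: under `H¹`-control `∫ |∇u(t)|² ≤ D < ∞` on `[0, t₀]`
every level above `log₂ (C D/(cν)²)` is quiet there (`TerminalWindowFloor.not_isSaturatedLevel_of_lt`), so the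
front stays below those levels before `t₀` and their occupation on `(T/2, T)` is carried entirely by `(t₀, T)`:

* `not_front_of_dissipation_lt` — quiet high levels keep the front down: `¬ 2^q ≤ Λ_c(u(τ))` for `τ ≤ t₀`, `q ≥ 1`,
  `C D < (cν)² 2^q` (with `exists_isSaturatedLevel_of_two_pow_succ_le`, the tree's level-set dictionary of `Λ`);
* `occupation_lastHalf_le_window` — hence `O_q(T/2, T) ≤ O_q(t₀, T)` for those `q` (unconditional bookkeeping);
* `occupation_floor_window` — conditionally on `cheskidov_dai_occupation`: for every maximal smooth solution with
  finite lifespan `T`, Leray–Hopf from its rapidly decaying datum, every `t₀ < T` with `H¹`-control on `[0, t₀]`: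
  `c < limsup_q O_q(t₀, T)` — the occupation must be delivered AFTER `t₀`, however late;
* `occupation_le_residence_window` + `residence_floor_window` — `O_q(t₀,T) ≤ 2^q · U_q(t₀,T) · R_q(t₀,T)`, so at
  infinitely many levels `2^q · (sup_{t ∈ (t₀,T)} ‖Δ̇_q u(t)‖_∞) · |{t ∈ (t₀,T) : Λ_c(u(t)) ≥ 2^q}| > c`: the front must
  dwell at or above level `q` for `c` eddy turn-overs INSIDE every terminal window — the clock is met arbitrarily close
  to the blow-up time, at arbitrarily fine levels (the shape of the atlas's occupation companion
  `O = k_out · U_out,pk · τ_res`, RULING R35 F6, read late).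

0 sorry; conditional results carry the hypothesis `(h : cheskidov_dai_occupation)` explicitly; the `H¹`-control is an
explicit hypothesis (weak gradients `G t` with `∫ |G t|² ≤ D` on `[0, t₀]`), as in `TerminalWindowFloor.exists_quiet_then_saturated`.

## References

* A. Cheskidov, M. Dai, arXiv:1507.06611 = Proc. Edinburgh Math. Soc. (2025), Thm. 1.1. [CheskidovDai2015]
* A. Cheskidov, R. Shvydkoy, J. Math. Fluid Mech. 16 (2014) 263–273, §3 and Lemma 4.1. [CheskidovShvydkoy2011]
-/

noncomputable section

open MeasureTheory Set Function Filter Topology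
open scoped ENNReal NNReal
open Literature.Analysis.FluidPDE Literature.Analysis.FunctionSpaces
open Summit.NavierStokesRegularity.FluidComputer.TerminalWindowFloor
open Summit.NavierStokesRegularity.FluidComputer.LevelOccupationFloor

namespace Summit.NavierStokesRegularity.FluidComputer.OccupationWindowFloor

/-- **Quiet high levels keep the front down.** With the Bernstein constant `C` of
`TerminalWindowFloor.not_isSaturatedLevel_of_lt`: an `L²` slice `v` with weak gradient `G`, `∫|G|² ≤ D < ∞`, and a level
`q ≥ 1` with `C D < (c ν)² 2^q` has its dissipation wavenumber below `2^q`: `¬ 2^q ≤ Λ_c(v)` (otherwise some level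
`j ≥ q` would be saturated, tree `exists_isSaturatedLevel_of_two_pow_succ_le`, contradicting the Bernstein bound).
[cite: CheskidovShvydkoy2011, Lemma 4.1] -/
theorem not_front_of_dissipation_lt :
    ∃ C : ℝ≥0, ∀ (c ν : ℝ) (q : ℕ) (v : EuclideanSpace ℝ (Fin 3) → EuclideanSpace ℝ (Fin 3))
      (G : EuclideanSpace ℝ (Fin 3) → EuclideanSpace ℝ (Fin 3) →L[ℝ] EuclideanSpace ℝ (Fin 3)) (D : ℝ≥0∞),
      MemLp v 2 volume → HasWeakGradient v G →
      (∫⁻ x, ENNReal.ofReal (frobeniusNormSq (G x))) ≤ D → D < ∞ → 1 ≤ q →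
      (C : ℝ≥0∞) * D < ENNReal.ofReal (c * ν) ^ 2 * 2 ^ q →
      ¬ (2 : ℝ≥0∞) ^ q ≤ dissipationWavenumber c ν v := by
  obtain ⟨C, hC⟩ := not_isSaturatedLevel_of_lt
  refine ⟨C, fun c ν q v G D hv hG hGD hD hq hlt hfront => ?_⟩
  obtain ⟨n, rfl⟩ : ∃ n, q = n + 1 := ⟨q - 1, by omega⟩
  obtain ⟨j, hnj, hsat⟩ := exists_isSaturatedLevel_of_two_pow_succ_le hfront
  refine hC c ν j v G hv hG (hGD.trans_lt hD) ?_ hsat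
  calc (C : ℝ≥0∞) * (∫⁻ x, ENNReal.ofReal (frobeniusNormSq (G x))) ≤ (C : ℝ≥0∞) * D := by gcongr
    _ < ENNReal.ofReal (c * ν) ^ 2 * 2 ^ (n + 1) := hlt
    _ ≤ ENNReal.ofReal (c * ν) ^ 2 * 2 ^ j := by
        gcongr
        · exact one_le_two
        · exact Nat.succ_le_of_lt hnj

/-- **Early occupation vanishes at high levels, so the last-half occupation is carried by the terminal window**
(unconditional bookkeeping). If the slices on `[0, t₀]` are in `L²` with weak gradients `G t`, `∫|G t|² ≤ D < ∞`, then
for every `T > 0` and every level `q ≥ 1` with `C D < (c ν)² 2^q`: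
`O_q(T/2, T) := ∫_{(T/2,T)} 1_{2^q ≤ Λ_c(u t)} 2^q ‖Δ̇_q u(t)‖_∞ dt ≤ O_q(t₀, T)` (same integrand over `(t₀, T)`): the
indicator vanishes for `t ≤ t₀` by `not_front_of_dissipation_lt`. [folklore] -/
theorem occupation_lastHalf_le_window :
    ∃ C : ℝ≥0, ∀ (c ν T t₀ : ℝ) (q : ℕ) (u : ℝ → EuclideanSpace ℝ (Fin 3) → EuclideanSpace ℝ (Fin 3))
      (G : ℝ → EuclideanSpace ℝ (Fin 3) → EuclideanSpace ℝ (Fin 3) →L[ℝ] EuclideanSpace ℝ (Fin 3)) (D : ℝ≥0∞),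
      0 < T → D < ∞ →
      (∀ t ∈ Icc 0 t₀, MemLp (u t) 2 volume ∧ HasWeakGradient (u t) (G t) ∧
        (∫⁻ x, ENNReal.ofReal (frobeniusNormSq (G t x))) ≤ D) →
      1 ≤ q → (C : ℝ≥0∞) * D < ENNReal.ofReal (c * ν) ^ 2 * 2 ^ q →
      (∫⁻ τ in Ioo (T / 2) T, {τ | (2 : ℝ≥0∞) ^ q ≤ dissipationWavenumber c ν (u τ)}.indicator
          (fun τ => (2 : ℝ≥0∞) ^ q * eLpNorm (blockFn (q : ℤ) (u τ)) ∞ volume) τ) ≤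
        ∫⁻ τ in Ioo t₀ T, {τ | (2 : ℝ≥0∞) ^ q ≤ dissipationWavenumber c ν (u τ)}.indicator
          (fun τ => (2 : ℝ≥0∞) ^ q * eLpNorm (blockFn (q : ℤ) (u τ)) ∞ volume) τ := by
  obtain ⟨C, hC⟩ := not_front_of_dissipation_lt
  refine ⟨C, fun c ν T t₀ q u G D hT hD hctrl hq hlt => ?_⟩
  set A : Set ℝ := {τ | (2 : ℝ≥0∞) ^ q ≤ dissipationWavenumber c ν (u τ)} with hA
  set f : ℝ → ℝ≥0∞ := A.indicator (fun τ => (2 : ℝ≥0∞) ^ q * eLpNorm (blockFn (q : ℤ) (u τ)) ∞ volume) with hf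
  -- the integrand vanishes on `(T/2, T) ∖ (t₀, ∞)`: there `0 < τ ≤ t₀`, and the front is below `2^q`
  have hvan : EqOn f ((Ioi t₀).indicator f) (Ioo (T / 2) T) := by
    intro τ hτ
    by_cases hτt : τ ∈ Ioi t₀
    · rw [Set.indicator_of_mem hτt]
    · rw [Set.indicator_of_notMem hτt, hf, Set.indicator_of_notMem]
      have hτ0 : 0 ≤ τ := by linarith [hτ.1]
      obtain ⟨hv, hG, hGD⟩ := hctrl τ ⟨hτ0, not_lt.1 hτt⟩
      exact hC c ν q (u τ) (G τ) D hv hG hGD hD hq hlt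
  calc ∫⁻ τ in Ioo (T / 2) T, f τ = ∫⁻ τ in Ioo (T / 2) T, (Ioi t₀).indicator f τ :=
        setLIntegral_congr_fun measurableSet_Ioo hvan
    _ = ∫⁻ τ in Ioi t₀ ∩ Ioo (T / 2) T, f τ := by
        rw [lintegral_indicator measurableSet_Ioi, Measure.restrict_restrict measurableSet_Ioi]
    _ ≤ ∫⁻ τ in Ioo t₀ T, f τ := lintegral_mono_set fun τ hτ => ⟨hτ.1, hτ.2.2⟩

/-- **Occupation ≤ wavenumber × level sup-amplitude × residence time, on any window `(a, T)`** (the window version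
of `LevelOccupationFloor.occupation_le_residence`; bookkeeping, unconditional). [folklore] -/
theorem occupation_le_residence_window (c ν a T : ℝ)
    (u : ℝ → EuclideanSpace ℝ (Fin 3) → EuclideanSpace ℝ (Fin 3)) (q : ℕ) :
    (∫⁻ τ in Ioo a T, {τ | (2 : ℝ≥0∞) ^ q ≤ dissipationWavenumber c ν (u τ)}.indicator
        (fun τ => (2 : ℝ≥0∞) ^ q * eLpNorm (blockFn (q : ℤ) (u τ)) ∞ volume) τ) ≤
      (2 : ℝ≥0∞) ^ q * (⨆ τ ∈ Ioo a T, eLpNorm (blockFn (q : ℤ) (u τ)) ∞ volume) *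
        volume (Ioo a T ∩ {τ | (2 : ℝ≥0∞) ^ q ≤ dissipationWavenumber c ν (u τ)}) := by
  set S := Ioo a T with hS
  set A := {τ | (2 : ℝ≥0∞) ^ q ≤ dissipationWavenumber c ν (u τ)} with hA
  set M := (2 : ℝ≥0∞) ^ q * ⨆ τ ∈ S, eLpNorm (blockFn (q : ℤ) (u τ)) ∞ volume with hM
  have hpt : ∀ τ ∈ S, A.indicator (fun τ => (2 : ℝ≥0∞) ^ q * eLpNorm (blockFn (q : ℤ) (u τ)) ∞ volume) τ ≤
      A.indicator (fun _ => M) τ := fun τ hτ =>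
    Set.indicator_le_indicator (mul_le_mul' le_rfl
      (le_iSup₂_of_le (f := fun τ (_ : τ ∈ S) => eLpNorm (blockFn (q : ℤ) (u τ)) ∞ volume) τ hτ le_rfl))
  calc (∫⁻ τ in S, A.indicator (fun τ => (2 : ℝ≥0∞) ^ q * eLpNorm (blockFn (q : ℤ) (u τ)) ∞ volume) τ)
      ≤ ∫⁻ τ in S, A.indicator (fun _ => M) τ := setLIntegral_mono' measurableSet_Ioo hpt
    _ = ∫⁻ τ, (S ∩ A).indicator (fun _ => M) τ := by
        rw [← lintegral_indicator measurableSet_Ioo, Set.indicator_indicator]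
    _ ≤ ∫⁻ τ in S ∩ A, M := lintegral_indicator_le _ _
    _ = M * volume (S ∩ A) := setLIntegral_const _ _
    _ = _ := by rw [hM]

/-- **The occupation floor inside every terminal window** (conditional on Cheskidov–Dai's criterion). There is an
absolute `c > 0` such that for every `ν > 0`, `T > 0`, every maximal smooth solution `(u, p)` of the unforced
Navier–Stokes system on `ℝ³ × [0, T)` with finite lifespan `T`, Leray–Hopf from its rapidly decaying datum `u 0`, and
every `t₀ ∈ [0, T)` up to which the dissipation is controlled (weak gradients `G t` of the slices, `∫ |G t|² ≤ D < ∞`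
on `[0, t₀]`): `c < limsup_{q → ∞} ∫_{(t₀,T)} 1_{2^q ≤ Λ_c(u t)} 2^q ‖Δ̇_q u(t)‖_∞ dt`. Proof: the last-half floor
`LevelOccupationFloor.occupation_floor` and `occupation_lastHalf_le_window` for all large `q`
(`Filter.limsup_le_limsup` along an eventual inequality). [cite: CheskidovDai2015, §1 Thm. 1.1] -/
theorem occupation_floor_window (h : cheskidov_dai_occupation) :
    ∃ c : ℝ, 0 < c ∧ ∀ (ν T : ℝ), 0 < ν → 0 < T →
      ∀ (u : ℝ → EuclideanSpace ℝ (Fin 3) → EuclideanSpace ℝ (Fin 3)) (p : ℝ → EuclideanSpace ℝ (Fin 3) → ℝ),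
      IsMaximalSmoothSolution ν 0 u p T → IsLerayHopfOn T ν 0 (u 0) u → HasRapidSpatialDecay (u 0) →
      ∀ t₀ ∈ Ico 0 T,
      ∀ (G : ℝ → EuclideanSpace ℝ (Fin 3) → EuclideanSpace ℝ (Fin 3) →L[ℝ] EuclideanSpace ℝ (Fin 3)) (D : ℝ≥0∞),
      D < ∞ →
      (∀ t ∈ Icc 0 t₀, HasWeakGradient (u t) (G t) ∧ (∫⁻ x, ENNReal.ofReal (frobeniusNormSq (G t x))) ≤ D) →
      ENNReal.ofReal c < limsup (fun q : ℕ => ∫⁻ τ in Ioo t₀ T,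
          {τ | (2 : ℝ≥0∞) ^ q ≤ dissipationWavenumber c ν (u τ)}.indicator
            (fun τ => (2 : ℝ≥0∞) ^ q * eLpNorm (blockFn (q : ℤ) (u τ)) ∞ volume) τ) atTop := by
  obtain ⟨c, hc, H⟩ := occupation_floor h
  obtain ⟨C, hC⟩ := occupation_lastHalf_le_window
  refine ⟨c, hc, fun ν T hν hT u p hmax hLH hdec t₀ ht₀ G D hD hG => ?_⟩
  have hfloor := H ν T hν hT u p hmax hLH hdec
  -- a level above which `[0, t₀]` is quiet: `(cν)² 2^q > C D` for `q ≥ n`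
  have ha : ENNReal.ofReal (c * ν) ^ 2 ≠ 0 := pow_ne_zero _ (ENNReal.ofReal_pos.2 (mul_pos hc hν)).ne'
  have hCD : (C : ℝ≥0∞) * D ≠ ∞ := ENNReal.mul_ne_top ENNReal.coe_ne_top hD.ne
  obtain ⟨n, hn⟩ := ENNReal.exists_nat_mul_gt ha hCD
  have hctrl : ∀ t ∈ Icc 0 t₀, MemLp (u t) 2 volume ∧ HasWeakGradient (u t) (G t) ∧
      (∫⁻ x, ENNReal.ofReal (frobeniusNormSq (G t x))) ≤ D := fun t ht =>
    ⟨hLH.memLp t ⟨ht.1, ht.2.trans ht₀.2.le⟩, (hG t ht).1, (hG t ht).2⟩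
  refine hfloor.trans_le (limsup_le_limsup (eventually_atTop.2 ⟨max n 1, fun q hq => ?_⟩))
  refine hC c ν T t₀ q u G D hT hD hctrl ((le_max_right n 1).trans hq) ?_
  calc (C : ℝ≥0∞) * D < n * ENNReal.ofReal (c * ν) ^ 2 := hn
    _ ≤ (2 : ℝ≥0∞) ^ q * ENNReal.ofReal (c * ν) ^ 2 := by
        gcongr
        calc (n : ℝ≥0∞) ≤ (q : ℝ≥0∞) := by exact_mod_cast (le_max_left n 1).trans hq
          _ ≤ (2 : ℝ≥0∞) ^ q := by exact_mod_cast (Nat.lt_two_pow_self (n := q)).le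
    _ = ENNReal.ofReal (c * ν) ^ 2 * 2 ^ q := mul_comm _ _

/-- **The residence (clock) floor inside every terminal window** (conditional on Cheskidov–Dai's criterion): in the
setting of `occupation_floor_window`, at INFINITELY MANY levels `q`
`c < 2^q · (sup_{t ∈ (t₀,T)} ‖Δ̇_q u(t)‖_∞) · |{t ∈ (t₀,T) : Λ_c(u(t)) ≥ 2^q}|` — wavenumber × level sup-velocity ×
residence time of the front at or above the level, all measured AFTER `t₀`: the front must dwell at or above level `q`
for at least `c` eddy turn-over times `(k_q U_q)⁻¹` inside every terminal window, infinitely often. This is the shape of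
the atlas's occupation companion `O = k_out · U_out,pk · τ_res` (RULING R35 F6), read in late windows.
[cite: CheskidovDai2015, §1 Thm. 1.1] -/
theorem residence_floor_window (h : cheskidov_dai_occupation) :
    ∃ c : ℝ, 0 < c ∧ ∀ (ν T : ℝ), 0 < ν → 0 < T →
      ∀ (u : ℝ → EuclideanSpace ℝ (Fin 3) → EuclideanSpace ℝ (Fin 3)) (p : ℝ → EuclideanSpace ℝ (Fin 3) → ℝ),
      IsMaximalSmoothSolution ν 0 u p T → IsLerayHopfOn T ν 0 (u 0) u → HasRapidSpatialDecay (u 0) →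
      ∀ t₀ ∈ Ico 0 T,
      ∀ (G : ℝ → EuclideanSpace ℝ (Fin 3) → EuclideanSpace ℝ (Fin 3) →L[ℝ] EuclideanSpace ℝ (Fin 3)) (D : ℝ≥0∞),
      D < ∞ →
      (∀ t ∈ Icc 0 t₀, HasWeakGradient (u t) (G t) ∧ (∫⁻ x, ENNReal.ofReal (frobeniusNormSq (G t x))) ≤ D) →
      ∃ᶠ q : ℕ in atTop, ENNReal.ofReal c <
        (2 : ℝ≥0∞) ^ q * (⨆ τ ∈ Ioo t₀ T, eLpNorm (blockFn (q : ℤ) (u τ)) ∞ volume) *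
          volume (Ioo t₀ T ∩ {τ | (2 : ℝ≥0∞) ^ q ≤ dissipationWavenumber c ν (u τ)}) := by
  obtain ⟨c, hc, H⟩ := occupation_floor_window h
  refine ⟨c, hc, fun ν T hν hT u p hmax hLH hdec t₀ ht₀ G D hD hG => ?_⟩
  have hlim := H ν T hν hT u p hmax hLH hdec t₀ ht₀ G D hD hG
  exact (frequently_lt_of_lt_limsup (by isBoundedDefault) hlim).mono fun q hq =>
    hq.trans_le (occupation_le_residence_window c ν t₀ T u q)

/-- **Positive residence after `t₀` at infinitely many levels** (conditional on Cheskidov–Dai's criterion): in the same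
setting, the front `Λ_c(u(t))` is at or above level `q` for a set of times of POSITIVE measure inside `(t₀, T)`, for
infinitely many `q`. [cite: CheskidovDai2015, §1 Thm. 1.1] -/
theorem residence_pos_window (h : cheskidov_dai_occupation) :
    ∃ c : ℝ, 0 < c ∧ ∀ (ν T : ℝ), 0 < ν → 0 < T →
      ∀ (u : ℝ → EuclideanSpace ℝ (Fin 3) → EuclideanSpace ℝ (Fin 3)) (p : ℝ → EuclideanSpace ℝ (Fin 3) → ℝ),
      IsMaximalSmoothSolution ν 0 u p T → IsLerayHopfOn T ν 0 (u 0) u → HasRapidSpatialDecay (u 0) →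
      ∀ t₀ ∈ Ico 0 T,
      ∀ (G : ℝ → EuclideanSpace ℝ (Fin 3) → EuclideanSpace ℝ (Fin 3) →L[ℝ] EuclideanSpace ℝ (Fin 3)) (D : ℝ≥0∞),
      D < ∞ →
      (∀ t ∈ Icc 0 t₀, HasWeakGradient (u t) (G t) ∧ (∫⁻ x, ENNReal.ofReal (frobeniusNormSq (G t x))) ≤ D) →
      ∃ᶠ q : ℕ in atTop,
        0 < volume (Ioo t₀ T ∩ {τ | (2 : ℝ≥0∞) ^ q ≤ dissipationWavenumber c ν (u τ)}) := by
  obtain ⟨c, hc, H⟩ := residence_floor_window h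
  refine ⟨c, hc, fun ν T hν hT u p hmax hLH hdec t₀ ht₀ G D hD hG =>
    (H ν T hν hT u p hmax hLH hdec t₀ ht₀ G D hD hG).mono fun q hq => pos_iff_ne_zero.2 fun h0 => ?_⟩
  rw [h0, mul_zero] at hq
  exact ENNReal.not_lt_zero hq

/-- **The plain (indicator-free) occupation floor inside every terminal window** (conditional on Cheskidov–Dai's criterion):
dropping the front indicator `1_{2^q ≤ Λ}` only enlarges the occupation, so in the setting of `occupation_floor_window`
`c < limsup_{q → ∞} ∫_{(t₀,T)} 2^q ‖Δ̇_q u(t)‖_∞ dt` — at infinitely many levels the time integral of wavenumber × level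
sup-velocity over the window `(t₀, T)` exceeds the absolute constant `c`, however late `t₀ < T` is chosen. This is the
cleanest form of the rung's CLOCK (RULING R35 F4/F6): in cascade units, `∫ k_q U_q(t) dt ≳ c` eddy turn-overs per occupied
level, inside every terminal window; the atlas's companion `O = k_out · U_out,pk · τ_res` satisfies `O ≤ 2 · ∫ k_out U_out dt`
over the residence set (where `U_out ≥ U_out,pk / 2`). [cite: CheskidovDai2015, §1 Thm. 1.1] -/
theorem plain_occupation_floor_window (h : cheskidov_dai_occupation) :
    ∃ c : ℝ, 0 < c ∧ ∀ (ν T : ℝ), 0 < ν → 0 < T →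
      ∀ (u : ℝ → EuclideanSpace ℝ (Fin 3) → EuclideanSpace ℝ (Fin 3)) (p : ℝ → EuclideanSpace ℝ (Fin 3) → ℝ),
      IsMaximalSmoothSolution ν 0 u p T → IsLerayHopfOn T ν 0 (u 0) u → HasRapidSpatialDecay (u 0) →
      ∀ t₀ ∈ Ico 0 T,
      ∀ (G : ℝ → EuclideanSpace ℝ (Fin 3) → EuclideanSpace ℝ (Fin 3) →L[ℝ] EuclideanSpace ℝ (Fin 3)) (D : ℝ≥0∞),
      D < ∞ →
      (∀ t ∈ Icc 0 t₀, HasWeakGradient (u t) (G t) ∧ (∫⁻ x, ENNReal.ofReal (frobeniusNormSq (G t x))) ≤ D) →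
      ENNReal.ofReal c < limsup (fun q : ℕ => ∫⁻ τ in Ioo t₀ T,
          (2 : ℝ≥0∞) ^ q * eLpNorm (blockFn (q : ℤ) (u τ)) ∞ volume) atTop := by
  obtain ⟨c, hc, H⟩ := occupation_floor_window h
  refine ⟨c, hc, fun ν T hν hT u p hmax hLH hdec t₀ ht₀ G D hD hG => ?_⟩
  refine (H ν T hν hT u p hmax hLH hdec t₀ ht₀ G D hD hG).trans_le
    (limsup_le_limsup (Eventually.of_forall fun q => lintegral_mono fun τ => ?_))
  exact Set.indicator_le_self _ _ τ

/-- **Infinitely many levels with plain occupation above `c` after `t₀`** (the `∃ᶠ` form of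
`plain_occupation_floor_window`). [cite: CheskidovDai2015, §1 Thm. 1.1] -/
theorem frequently_plain_occupation_gt_window (h : cheskidov_dai_occupation) :
    ∃ c : ℝ, 0 < c ∧ ∀ (ν T : ℝ), 0 < ν → 0 < T →
      ∀ (u : ℝ → EuclideanSpace ℝ (Fin 3) → EuclideanSpace ℝ (Fin 3)) (p : ℝ → EuclideanSpace ℝ (Fin 3) → ℝ),
      IsMaximalSmoothSolution ν 0 u p T → IsLerayHopfOn T ν 0 (u 0) u → HasRapidSpatialDecay (u 0) →
      ∀ t₀ ∈ Ico 0 T,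
      ∀ (G : ℝ → EuclideanSpace ℝ (Fin 3) → EuclideanSpace ℝ (Fin 3) →L[ℝ] EuclideanSpace ℝ (Fin 3)) (D : ℝ≥0∞),
      D < ∞ →
      (∀ t ∈ Icc 0 t₀, HasWeakGradient (u t) (G t) ∧ (∫⁻ x, ENNReal.ofReal (frobeniusNormSq (G t x))) ≤ D) →
      ∃ᶠ q : ℕ in atTop, ENNReal.ofReal c < ∫⁻ τ in Ioo t₀ T,
          (2 : ℝ≥0∞) ^ q * eLpNorm (blockFn (q : ℤ) (u τ)) ∞ volume := by
  obtain ⟨c, hc, H⟩ := plain_occupation_floor_window h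
  exact ⟨c, hc, fun ν T hν hT u p hmax hLH hdec t₀ ht₀ G D hD hG =>
    frequently_lt_of_lt_limsup (by isBoundedDefault) (H ν T hν hT u p hmax hLH hdec t₀ ht₀ G D hD hG)⟩

/-! ## The dwell-time CEILING (unconditional): the front spends at most `2^{-q} ∫Λ` at or above level `q` -/

/-- **Residence ceiling, per level and per window** (unconditional; the single-level form of the budget rail
`LevelOccupationFloor.sum_innerResidence_le`): for every trajectory, window `(a, T)`, threshold and level `q`, the inner
residence of the front at or above level `q` obeys `2^q · ∫_{(a,T)} 1_{2^q ≤ Λ_c(u t)} dt ≤ ∫_{(a,T)} Λ_c(u t) dt`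
(pointwise `2^q 1_{2^q ≤ Λ} ≤ Λ`). [cite: CheskidovShvydkoy2011, §3 (definition of Λ)] -/
theorem two_pow_mul_innerResidence_le (c ν a T : ℝ)
    (u : ℝ → EuclideanSpace ℝ (Fin 3) → EuclideanSpace ℝ (Fin 3)) (q : ℕ) :
    (2 : ℝ≥0∞) ^ q * ∫⁻ τ in Ioo a T, {τ | (2 : ℝ≥0∞) ^ q ≤ dissipationWavenumber c ν (u τ)}.indicator
        (fun _ => (1 : ℝ≥0∞)) τ ≤
      ∫⁻ τ in Ioo a T, dissipationWavenumber c ν (u τ) := by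
  rw [← lintegral_const_mul' _ _ (ENNReal.pow_ne_top ENNReal.ofNat_ne_top)]
  refine lintegral_mono fun τ => ?_
  by_cases hτ : τ ∈ {τ | (2 : ℝ≥0∞) ^ q ≤ dissipationWavenumber c ν (u τ)}
  · rw [Set.indicator_of_mem hτ, mul_one]; exact hτ
  · rw [Set.indicator_of_notMem hτ, mul_zero]; exact bot_le

/-- **The dwell-time ceiling of a Leray–Hopf trajectory** (unconditional; Cheskidov–Shvydkoy 2014 Lemma 4.1 in
residence currency, tree `exists_lintegral_dissipationWavenumber_le`): there is an absolute `C` (Bernstein) such that for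
`c > 0`, `ν > 0`, `T > 0`, every Leray–Hopf solution `u` on `ℝ³ × [0,T)` from `u 0`, every window start `a ≥ 0` and every
level `q`: `2^q · ∫_{(a,T)} 1_{2^q ≤ Λ_c(u t)} dt ≤ T + C E(u 0)/(c² ν³)` — the front can dwell at or above level `q` for
at most `2^{-q} · (T + C E/(c²ν³))`. With the conditional clock FLOOR `residence_floor_window`
(`2^q U_q R_q > c` at infinitely many levels) this brackets the residence of the occupied levels:
`c/(2^q U_q) < R_q ≤ 2^{-q} B`, `B = T + C E/(c²ν³)` — so the level amplitudes at the occupied levels exceed `c/B`,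
and in cascade units the dwell time at wavenumber `k_q` lies between `c` turn-over times and `B/k_q`.
[cite: CheskidovShvydkoy2011, Lemma 4.1] -/
theorem innerResidence_le_budget :
    ∃ C : ℝ≥0, ∀ (c ν T a : ℝ) (u : ℝ → EuclideanSpace ℝ (Fin 3) → EuclideanSpace ℝ (Fin 3)),
      0 < c → 0 < ν → 0 < T → 0 ≤ a → IsLerayHopfOn T ν 0 (u 0) u → ∀ q : ℕ,
      (2 : ℝ≥0∞) ^ q * ∫⁻ τ in Ioo a T, {τ | (2 : ℝ≥0∞) ^ q ≤ dissipationWavenumber c ν (u τ)}.indicator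
          (fun _ => (1 : ℝ≥0∞)) τ ≤
        ENNReal.ofReal T + ENNReal.ofReal (C * VectorCalculus.kineticEnergy (u 0) / (c ^ 2 * ν ^ 3)) := by
  obtain ⟨C, hC⟩ := exists_lintegral_dissipationWavenumber_le
  refine ⟨C, fun c ν T a u hc hν hT ha hLH q => ?_⟩
  calc (2 : ℝ≥0∞) ^ q * ∫⁻ τ in Ioo a T, {τ | (2 : ℝ≥0∞) ^ q ≤ dissipationWavenumber c ν (u τ)}.indicator
          (fun _ => (1 : ℝ≥0∞)) τ
      ≤ ∫⁻ τ in Ioo a T, dissipationWavenumber c ν (u τ) := two_pow_mul_innerResidence_le c ν a T u q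
    _ ≤ ∫⁻ τ in Ioo 0 T, dissipationWavenumber c ν (u τ) := lintegral_mono_set (Ioo_subset_Ioo ha le_rfl)
    _ ≤ _ := hC c ν T (u 0) u hc hν hT hLH

end Summit.NavierStokesRegularity.FluidComputer.OccupationWindowFloor

end
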